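import Literature.AnabelianGeometry.EtaleTheta.Discharge.Sec3Thm37Cnst
import Literature.AnabelianGeometry.EtaleTheta.Discharge.Sec5OfConnectedTemperoid

/-!
# [EtTh] Lemma 5.8's factorisation step: the conjugation action of `Aut_D(B_N^bs)` on `O^×(B_N)` through `s^⊓-gp_N`
# factors through the constant-field functor — the §5 binder `hfac` (GAP G-L2d4-1) reduced one level down by
# Theorem 3.7 (iii) (pp. 303–306, 322, 331 / PDF pp. 77–80, 96, 105)

Mochizuki, *The étale theta function and its Frobenioid-theoretic manifestations*, Publ. RIMS **45** (2009)
[cite: MochizukiEtTh2009, Thm 3.7 (iii) p.305–306 (PDF pp.79–80); Lem 5.8 p.331 (PDF p.105); §5 p.322 (PDF p.96)].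
abc-iut cell, cross-layer piece by signature for layer L2 (seat abc-iut-w4-d008, gen 4); GAP-LEDGER row **G-L2d4-1**
(binder `hfac` of abc-iut-L2-d4's `ThetaFrobenioid.discrepancy_mem_OKxRootN` / `thm510_ii_iii_of_torsion` /
`ThetaFrobenioidTower.thetaRootPreservedAll_of_torsion`, `Discharge/Sec5Thm57Constants.lean`; `hfac₁` of the Thm. 5.7
family files p429665 / p430430).  PROOF-ONLY over abc-iut-w5-d233's `Discharge/Sec3Thm37Cnst.lean` (Theorem 3.7 (iii) PROVED
from abc-iut-L2-t3's `RealifiedDivisorMonoids.Prop34Cnst`) and abc-iut-L2-t4's assembled §5 data; 0 definitions, no new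
named fact.

`hfac` reads (Sec5Thm57Constants l.177): «every `y ∈ Im(Π^tp_Y̲) ⊆ Aut_D(B_N^bs)` acts on `O^×(B_N)` — by conjugation through
the lift `s^⊓-gp_N` — like some `h ∈ H_{B_N} = Im(Π^tp_Ÿ̲)`».  Print's reason (Lemma 5.8 proof, p.331 (PDF p.105): "`Π^tp_Y`
[i.e., `G_K`, via the natural surjection `Π^tp_Y ↠ G_K`] acts …"): the action of `Aut_C(B_N)` on the constants `O^×(B_N)`
FACTORS THROUGH `Aut_{D^cnst}(B_N^cnst)` — which is exactly **Theorem 3.7 (iii), first clause** (p.305 (PDF p.79): "the natural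
action of `Aut_C(A)` on `O^▷(A)` and `O^×(A)` factors through `Aut_{D^cnst}(A^cnst)`"), a THEOREM in the tree for every
tempered Frobenioid whose Def. 3.6 (i) data satisfy Prop. 3.4 (ii) relative to a constant-field functor `cnst : D₀ → D^cnst`
(`TemperedFrobenioid.conj_eq_conj_of_cnst_map_eq` / `autActionFactorsThrough_of_prop34Cnst`).  Hence:

* `TemperedFrobenioid.aut_conj_units_eq_of_cnst_map_eq` — in the group `Aut_C(A)`: `e · u · e⁻¹ = e' · u · e'⁻¹` for every
  `u ∈ O^×(A)` as soon as `e, e'` have the same image in `Aut_{D^cnst}(A^cnst)` (Thm. 3.7 (iii) in the `Aut`-group spelling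
  of `hfac`);
* `ThetaFrobenioid.sgpCap_conj_units_eq_of_cnst_map_eq` — for abc-iut-L2-t4's assembled §5 data `𝔉 := ofBiKummerData …` over
  ANY §4 setting (section input `hσ` of [FrdI] Prop. 5.6, as in p425515): `s^⊓-gp_N(y) · u · s^⊓-gp_N(y)⁻¹ =
  s^⊓-gp_N(h) · u · s^⊓-gp_N(h)⁻¹` on `O^×(B_N)` whenever `y, h ∈ Aut_D(B_N^bs)` have the same image in
  `Aut_{D^cnst}((B_N^bs)^cnst)` (`Base(s^⊓-gp_N(g)) = g`, `SgpCapSection`) — **the conjugation action through `s^⊓-gp_N`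
  FACTORS THROUGH `cnst`**;
* **`ThetaFrobenioid.hfac_ofBiKummerData_of_cnst`** — `hfac` VERBATIM ⟸ `Prop34Cnst T₀ cnst` + `hcnst` := «every
  `y ∈ Im(Π^tp_Y̲)` has the same image in `Aut_{D^cnst}((B_N^bs)^cnst)` as some `h ∈ H_{B_N} = Im(Π^tp_Ÿ̲)`» (print: both
  surject onto the image of `G_K` since `Ÿ` is geometrically connected over `K = K̈`, §5 p.322 (PDF p.96)); and
  `hfac_ofConnectedTemperoidData_of_cnst` — the same at the genuine connected base `B^temp(Π^tp_X)⁰`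
  (`ofConnectedTemperoidData`, `hσ` discharged by `baseMap_strvOfBiKummerData`).
So the Frobenioid-unit quantifier of G-L2d4-1 disappears: the residual `hcnst` is a statement about the base tower
`D → D₀ → D^cnst` and the two subgroups `Im(Π^tp_Y̲) ⊇ Im(Π^tp_Ÿ̲)` of `Aut_D(B_N^bs)` only — the same «origin clause» family
as abc-iut-w5-d020's `hΔcnst` (G-w5d020-2, `Discharge/Sec5UnitsFixedByGeometricOfCnst.lean`), to be discharged where `cnst`
is instantiated on the Galois side (`D^cnst = B(G_K)⁰`, `cnst` induced by `Π^tp_X ↠ G_K`, §3 p.298 (PDF p.72)).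
HONEST FRAMING: kernel-checked implications between typed statements about the assembled §5 data; [EtTh] is refereed; nothing
asserts that such data exist for an actual curve; typed ≠ discharged; no side taken on [IUTchIII] Cor. 3.12.
-/

noncomputable section

namespace Literature.AnabelianGeometry.EtaleTheta

open CategoryTheory Opposite Literature.AlgebraicGeometry.Frobenioids

universe u₀ v₀ u₁ v₁ u v w

/-! ### Theorem 3.7 (iii) in the `Aut`-group spelling -/

namespace TemperedFrobenioid

variable {D₀ : Type u₀} [Category.{v₀} D₀] {V : FrdIMonoidStub.{w}} {T : RealifiedDivisorMonoids (D₀ := D₀) V}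
  {D : Type u} [Category.{v} D] {VD : FrdICatStub.{u, v, w} D} (C₀ : TemperedFrobenioid T D VD)
  {Dcnst : Type u₁} [Category.{v₁} Dcnst] {cnst : D₀ ⥤ Dcnst}

/-- In the group `Aut_C(A)`: `(e · w · e⁻¹).hom = e⁻¹ ≫ w ≫ e` (diagrammatic; Mathlib's `Aut` multiplies by `trans` on the
right). [folklore] -/
private theorem aut_conj_hom {A : C₀.category} (e w : Aut A) : (e * w * e⁻¹).hom = e.inv ≫ w.hom ≫ e.hom := by
  rw [Aut.Aut_mul_def, Aut.Aut_mul_def, Aut.Aut_inv_def, Iso.trans_hom, Iso.trans_hom, Iso.symm_hom]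

/-- **Theorem 3.7 (iii), first clause, in the `Aut`-group spelling**: for a tempered Frobenioid whose Def. 3.6 (i) data
satisfy Prop. 3.4 (ii) relative to `cnst : D₀ → D^cnst` (`Prop34Cnst`), automorphisms `e, e'` of `A` with the same image in
`Aut_{D^cnst}(A^cnst)` conjugate every `u ∈ O^×(A)` identically: `e · u · e⁻¹ = e' · u · e'⁻¹` ("the natural action of
`Aut_C(A)` on … `O^×(A)` factors through `Aut_{D^cnst}(A^cnst)`", p.305 (PDF p.79); abc-iut-w5-d233's
`conj_eq_conj_of_cnst_map_eq`).  [cite: MochizukiEtTh2009, Thm 3.7 (iii) p.305 (PDF p.79)] -/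
theorem aut_conj_units_eq_of_cnst_map_eq (P : T.Prop34Cnst cnst) {A : C₀.category} {e e' : Aut A}
    (h : cnst.map (C₀.base.map (ModelFrobenioid.baseMap e.hom)) = cnst.map (C₀.base.map (ModelFrobenioid.baseMap e'.hom)))
    {u : Aut A} (hu : u ∈ ModelFrobenioid.units A) : e * u * e⁻¹ = e' * u * e'⁻¹ := by
  apply Aut.ext
  rw [aut_conj_hom, aut_conj_hom]
  exact C₀.conj_eq_conj_of_cnst_map_eq P h ⟨hu.1, hu.2⟩

end TemperedFrobenioid

/-! ### At the assembled §5 data: conjugation through `s^⊓-gp_N` factors through `cnst`; `hfac` reduced -/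

namespace ThetaFrobenioid

section Kummer

variable {K : Type u₀} [Field K] {X : SemiGraphs.TemperedArithmeticGroup.{u₀} K} {D₀ : Type u₀} [Category.{v₀} D₀]
  {V : FrdIMonoidStub.{w}} {T₀ : RealifiedDivisorMonoids (D₀ := D₀) V} {D : Type u} [Category.{v} D]
  {VD : FrdICatStub.{u, v, w} D} {S : BiKummerSetting X T₀ D VD}
  {pullFrac : ∀ {A A' : S.C} (_ : A' ⟶ A), S.biratUnits A → S.biratUnits A'}
  {lv N : ℕ+} {T : ThetaEnvData.{max v w} N} {θ : S.biratUnits S.Aodot} {Bl : S.C}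
  {Pl : S.FractionPair θ Bl} {Rl : S.NthRoot θ Pl lv pullFrac}
  (h : ModelFrobenioid.Hypotheses S.tf.divisorMonoid S.tf.ratFnFunctor)
  (toB : ∀ A : S.C, S.biratUnits A →* S.tf.biratUnitsModel A) (Q : FrobenioidTheta.ThetaSubquotientStub.{w} D)
  (odd_l : Odd (lv : ℕ)) (R : S.NthRoot Rl.root Rl.pair N pullFrac) (ιX : T.PiX ≃ₜ* X.Pi)
  (hopen : IsOpen ((S.galoisSurj R.AN.base R.αData.isGalois).ker : Set X.Pi)) (σ : Aut R.AN.base →* Aut R.AN)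
  (K' : Type w) [Field K'] (constEmb : K'ˣ →* S.tf.biratUnitsModel R.BN)
  (constEmb_injective : Function.Injective constEmb)
  (hdivc : ∀ g : Aut R.BN.base,
    ModelFrobenioid.div ((σ ((BiKummerSetting.NthRoot.baseIso S R).conjAut.symm g)).hom ≫ R.pair.num) =
      ModelFrobenioid.div R.pair.num)
  (hdivp : ∀ y : T.PiYdd,
    ModelFrobenioid.div ((σ (S.galoisSurj R.AN.base R.αData.isGalois (ιX y.1))).hom ≫ R.pair.den) =
      ModelFrobenioid.div R.pair.den)
  {Dcnst : Type u₁} [Category.{v₁} Dcnst] {cnst : D₀ ⥤ Dcnst}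

/-- `Base(s^⊓-gp_N(g)) = g` on arrows (the section property `SgpCapSection` of the assembled data, from `hσ`).
[cite: MochizukiEtTh2009, §5 p.331 (PDF p.105)] -/
theorem baseMap_sgpCap_hom (hσ : ∀ g : Aut R.AN.base, ModelFrobenioid.baseMap (σ g).hom = g.hom)
    (g : Aut R.BN.base) :
    ModelFrobenioid.baseMap
        ((ofBiKummerData h toB Q odd_l R ιX hopen σ K' constEmb constEmb_injective hdivc hdivp).sgpCap g).hom = g.hom :=
  congrArg Iso.hom (sgpCapSection_ofBiKummerData h toB Q odd_l R ιX hopen σ K' constEmb constEmb_injective hdivc hdivp hσ g)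

include h in
/-- **The conjugation action of `Aut_D(B_N^bs)` on `O^×(B_N)` through `s^⊓-gp_N` FACTORS THROUGH `cnst`** (Lemma 5.8 proof,
p.331 (PDF p.105): "`Π^tp_Y` [i.e., `G_K` …] acts"; = Theorem 3.7 (iii) at `B_N` read through the section `s^⊓-gp_N`): for
`y, h ∈ Aut_D(B_N^bs)` with the same image in `Aut_{D^cnst}((B_N^bs)^cnst)` and every `u ∈ O^×(B_N)`,
`s^⊓-gp_N(y) · u · s^⊓-gp_N(y)⁻¹ = s^⊓-gp_N(h) · u · s^⊓-gp_N(h)⁻¹`.  Inputs: the section property `hσ` ([FrdI] Prop. 5.6) and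
abc-iut-L2-t3's `Prop34Cnst` (Prop. 3.4 (ii)).  [cite: MochizukiEtTh2009, Lem 5.8 p.331 (PDF p.105); Thm 3.7 (iii) p.305 (PDF p.79)] -/
theorem sgpCap_conj_units_eq_of_cnst_map_eq (hσ : ∀ g : Aut R.AN.base, ModelFrobenioid.baseMap (σ g).hom = g.hom)
    (hP34 : RealifiedDivisorMonoids.Prop34Cnst T₀ cnst)
    {y k : Aut ((ofBiKummerData h toB Q odd_l R ιX hopen σ K' constEmb constEmb_injective hdivc hdivp).base.obj
      (ofBiKummerData h toB Q odd_l R ιX hopen σ K' constEmb constEmb_injective hdivc hdivp).BN)}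
    (hyk : cnst.map (S.tf.base.map y.hom) = cnst.map (S.tf.base.map k.hom))
    {u : Aut (ofBiKummerData h toB Q odd_l R ιX hopen σ K' constEmb constEmb_injective hdivc hdivp).BN}
    (hu : u ∈ (ofBiKummerData h toB Q odd_l R ιX hopen σ K' constEmb constEmb_injective hdivc hdivp).units
      (ofBiKummerData h toB Q odd_l R ιX hopen σ K' constEmb constEmb_injective hdivc hdivp).BN) :
    (ofBiKummerData h toB Q odd_l R ιX hopen σ K' constEmb constEmb_injective hdivc hdivp).sgpCap y * u *
        ((ofBiKummerData h toB Q odd_l R ιX hopen σ K' constEmb constEmb_injective hdivc hdivp).sgpCap y)⁻¹ =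
      (ofBiKummerData h toB Q odd_l R ιX hopen σ K' constEmb constEmb_injective hdivc hdivp).sgpCap k * u *
        ((ofBiKummerData h toB Q odd_l R ιX hopen σ K' constEmb constEmb_injective hdivc hdivp).sgpCap k)⁻¹ := by
  refine S.tf.aut_conj_units_eq_of_cnst_map_eq hP34 (A := R.BN) ?_ hu
  rw [baseMap_sgpCap_hom h toB Q odd_l R ιX hopen σ K' constEmb constEmb_injective hdivc hdivp hσ y,
    baseMap_sgpCap_hom h toB Q odd_l R ιX hopen σ K' constEmb constEmb_injective hdivc hdivp hσ k]
  exact hyk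

include h in
/-- **GAP G-L2d4-1 (`hfac`) REDUCED to the constant-field functor.**  The binder `hfac` of abc-iut-L2-d4's
`discrepancy_mem_OKxRootN` / `thm510_ii_iii_of_torsion` / `thetaRootPreservedAll_of_torsion` (VERBATIM shape) at the assembled
§5 data `ofBiKummerData …`, from `hσ`, abc-iut-L2-t3's `Prop34Cnst` and the origin clause `hcnst`: «every `y ∈ Im(Π^tp_Y̲)` has
the same image in `Aut_{D^cnst}((B_N^bs)^cnst)` as some `h ∈ H_{B_N} = Im(Π^tp_Ÿ̲)`» (print: both surject onto the image of
`G_K`, `Ÿ` being geometrically connected over `K = K̈`, §5 p.322 (PDF p.96); Lemma 5.8 proof p.331 (PDF p.105)).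
[cite: MochizukiEtTh2009, Lem 5.8 p.331 (PDF p.105); §5 p.322 (PDF p.96); Thm 3.7 (iii) p.305 (PDF p.79)] -/
theorem hfac_ofBiKummerData_of_cnst (hσ : ∀ g : Aut R.AN.base, ModelFrobenioid.baseMap (σ g).hom = g.hom)
    (hP34 : RealifiedDivisorMonoids.Prop34Cnst T₀ cnst)
    (hcnst : ∀ y ∈ (ofBiKummerData h toB Q odd_l R ιX hopen σ K' constEmb constEmb_injective hdivc hdivp).imPiY,
      ∃ k ∈ (ofBiKummerData h toB Q odd_l R ιX hopen σ K' constEmb constEmb_injective hdivc hdivp).HB,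
        cnst.map (S.tf.base.map y.hom) = cnst.map (S.tf.base.map k.hom)) :
    ∀ y ∈ (ofBiKummerData h toB Q odd_l R ιX hopen σ K' constEmb constEmb_injective hdivc hdivp).imPiY,
      ∃ k ∈ (ofBiKummerData h toB Q odd_l R ιX hopen σ K' constEmb constEmb_injective hdivc hdivp).HB,
        ∀ u ∈ (ofBiKummerData h toB Q odd_l R ιX hopen σ K' constEmb constEmb_injective hdivc hdivp).units
            (ofBiKummerData h toB Q odd_l R ιX hopen σ K' constEmb constEmb_injective hdivc hdivp).BN,
          (ofBiKummerData h toB Q odd_l R ιX hopen σ K' constEmb constEmb_injective hdivc hdivp).sgpCap y * u *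
              ((ofBiKummerData h toB Q odd_l R ιX hopen σ K' constEmb constEmb_injective hdivc hdivp).sgpCap y)⁻¹ =
            (ofBiKummerData h toB Q odd_l R ιX hopen σ K' constEmb constEmb_injective hdivc hdivp).sgpCap k * u *
              ((ofBiKummerData h toB Q odd_l R ιX hopen σ K' constEmb constEmb_injective hdivc hdivp).sgpCap k)⁻¹ := by
  intro y hy
  obtain ⟨k, hk, hyk⟩ := hcnst y hy
  exact ⟨k, hk, fun u hu =>
    sgpCap_conj_units_eq_of_cnst_map_eq h toB Q odd_l R ιX hopen σ K' constEmb constEmb_injective hdivc hdivp hσ hP34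
      hyk hu⟩

end Kummer

/-! ### At the genuine connected base `B^temp(Π^tp_X)⁰` (`ofConnectedTemperoidData`: `hσ` discharged) -/

section Connected

open Literature.AnabelianGeometry.SemiGraphs Literature.AnabelianGeometry.SemiGraphs.GaloisObjects

variable {K : Type u₀} [Field K] {X : SemiGraphs.TemperedArithmeticGroup.{u₀} K} {D₀ : Type u₀} [Category.{v₀} D₀]
  {V : FrdIMonoidStub.{w}} {T₀ : RealifiedDivisorMonoids (D₀ := D₀) V}
  {VD : FrdICatStub.{u₀ + 1, u₀, w} (ConnectedPart (BTemp X.Pi))}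
  {tf : TemperedFrobenioid T₀ (ConnectedPart (BTemp X.Pi)) VD} {hZ : tf.monoidType = MonoidType.Z}
  {hP : ∀ A : (ConnectedPart (BTemp X.Pi))ᵒᵖ, IsPerfect (tf.Φ.carrier A)}
  {NH : Subgroup (Field.absoluteGaloisGroup K) → tf.category → ℕ+ → Prop} {A₀ : tf.category}
  {hA₀ : PreFrobenioid.IsFrobeniusTrivial tf.toElem A₀} {hA₀' : SemiGraphs.IsGaloisObj A₀.base.obj}
  {pullFrac : ∀ {A A' : (BiKummerSetting.mkOfConnectedTemperoid X tf hZ hP NH A₀ hA₀ hA₀').C} (_ : A' ⟶ A),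
    (BiKummerSetting.mkOfConnectedTemperoid X tf hZ hP NH A₀ hA₀ hA₀').biratUnits A →
      (BiKummerSetting.mkOfConnectedTemperoid X tf hZ hP NH A₀ hA₀ hA₀').biratUnits A'}
  {lv N : ℕ+} {T : ThetaEnvData.{max u₀ w} N}
  {θ : (BiKummerSetting.mkOfConnectedTemperoid X tf hZ hP NH A₀ hA₀ hA₀').biratUnits
    (BiKummerSetting.mkOfConnectedTemperoid X tf hZ hP NH A₀ hA₀ hA₀').Aodot}
  {Bl : (BiKummerSetting.mkOfConnectedTemperoid X tf hZ hP NH A₀ hA₀ hA₀').C}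
  {Pl : (BiKummerSetting.mkOfConnectedTemperoid X tf hZ hP NH A₀ hA₀ hA₀').FractionPair θ Bl}
  {Rl : (BiKummerSetting.mkOfConnectedTemperoid X tf hZ hP NH A₀ hA₀ hA₀').NthRoot θ Pl lv pullFrac}
  (h : ModelFrobenioid.Hypotheses tf.divisorMonoid tf.ratFnFunctor)
  (Q : FrobenioidTheta.ThetaSubquotientStub.{w} (ConnectedPart (BTemp X.Pi))) (odd_l : Odd (lv : ℕ))
  (R : (BiKummerSetting.mkOfConnectedTemperoid X tf hZ hP NH A₀ hA₀ hA₀').NthRoot Rl.root Rl.pair N pullFrac)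
  (ιX : T.PiX ≃ₜ* X.Pi) (K' : Type w) [Field K'] (constEmb : K'ˣ →* tf.biratUnitsModel R.BN)
  (constEmb_injective : Function.Injective constEmb)
  (hinvc : ∀ g : Aut R.AN.base,
    pull tf.divisorMonoid g.hom (ModelFrobenioid.div R.pair.num) = ModelFrobenioid.div R.pair.num)
  (hinvp : ∀ y : T.PiX, y ∈ T.PiYdd →
    pull tf.divisorMonoid ((BiKummerSetting.mkOfConnectedTemperoid X tf hZ hP NH A₀ hA₀ hA₀').galoisSurj R.AN.base
      R.αData.isGalois (ιX y)).hom (ModelFrobenioid.div R.pair.den) = ModelFrobenioid.div R.pair.den)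
  {Dcnst : Type u₁} [Category.{v₁} Dcnst] {cnst : D₀ ⥤ Dcnst}

include h in
/-- **`hfac` at the genuine §5 data over `B^temp(Π^tp_X)⁰`** (abc-iut-L2-t4's `ofConnectedTemperoidData`, p427614: `hσ` is the
theorem `baseMap_strvOfBiKummerData`) ⟸ `Prop34Cnst T₀ cnst` + the origin clause `hcnst` («`Im(Π^tp_Y̲)` and
`H_{B_N} = Im(Π^tp_Ÿ̲)` have the same image in `Aut_{D^cnst}((B_N^bs)^cnst)`»).
[cite: MochizukiEtTh2009, Lem 5.8 p.331 (PDF p.105); §5 p.322 (PDF p.96); Thm 3.7 (iii) p.305 (PDF p.79)] -/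
theorem hfac_ofConnectedTemperoidData_of_cnst (hP34 : RealifiedDivisorMonoids.Prop34Cnst T₀ cnst)
    (hcnst : ∀ y ∈ (ofConnectedTemperoidData h Q odd_l R ιX K' constEmb constEmb_injective hinvc hinvp).imPiY,
      ∃ k ∈ (ofConnectedTemperoidData h Q odd_l R ιX K' constEmb constEmb_injective hinvc hinvp).HB,
        cnst.map (tf.base.map y.hom) = cnst.map (tf.base.map k.hom)) :
    ∀ y ∈ (ofConnectedTemperoidData h Q odd_l R ιX K' constEmb constEmb_injective hinvc hinvp).imPiY,
      ∃ k ∈ (ofConnectedTemperoidData h Q odd_l R ιX K' constEmb constEmb_injective hinvc hinvp).HB,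
        ∀ u ∈ (ofConnectedTemperoidData h Q odd_l R ιX K' constEmb constEmb_injective hinvc hinvp).units
            (ofConnectedTemperoidData h Q odd_l R ιX K' constEmb constEmb_injective hinvc hinvp).BN,
          (ofConnectedTemperoidData h Q odd_l R ιX K' constEmb constEmb_injective hinvc hinvp).sgpCap y * u *
              ((ofConnectedTemperoidData h Q odd_l R ιX K' constEmb constEmb_injective hinvc hinvp).sgpCap y)⁻¹ =
            (ofConnectedTemperoidData h Q odd_l R ιX K' constEmb constEmb_injective hinvc hinvp).sgpCap k * u *
              ((ofConnectedTemperoidData h Q odd_l R ιX K' constEmb constEmb_injective hinvc hinvp).sgpCap k)⁻¹ :=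
  hfac_ofBiKummerData_of_cnst h _ Q odd_l R ιX _ _ K' constEmb constEmb_injective _ _ (baseMap_strvOfBiKummerData h R)
    hP34 hcnst

end Connected

end ThetaFrobenioid

end Literature.AnabelianGeometry.EtaleTheta

end
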